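import Summits.CriticalPhenomena.CardyFormulaZ2.Theorems.RectilinearCardy.Negative.RectilinearCardySquareInstance
import Literature.Probability.RandomPlanarGeometry.PolygonalDomains
import Literature.Probability.RandomPlanarGeometry.ChordalCurveFamily

/-!
# `RectilinearCardy` (crux stmt-CriticalPhenomena-5660): a reflex-cornered instance — the L-shape (part 4)

Continuation of `RectilinearCardyReductions.lean` / `…SquareInstance.lean` / `…Shells.lean`
(structure lemmas extracted from the standing disprover's work file
`Cruxes/RectilinearCardy/Disproof.lean`, cycle 2, sorry-free). The tree's first conformal
rectangle with a REFLEX corner, built on `polygonDomain` (`PolygonalDomains.lean`):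

* `lVerts`, `isSimpleClosedPolygon_lVerts` (the hexagon `0, 2, 2+i, 1+i, 1+2i, 2i` is a simple
  closed polygon), `lShapeDomain`, `lMarks`, `lShapeQuad` (marks `0, 2, 1+i, 2i`: the reflex
  corner is a mark), `lShapeQuad_pt`, `frontier_lShapeQuad` (union of the six sides),
  `isRectilinear_lShapeQuad` (an instance of the crux);
* `swapL`, `swapH` (the reflection `z ↦ i z̄`), `swapH_image_frontier`, `swapH_image_carrier`
  (it preserves the L-shape: uniqueness of the inside of a Jordan curve,
  `JordanDomain.carrier_eq_of_frontier_eq`), `mapsTo_antiAffine_lShapeQuad`,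
  `crossRatio_lShapeQuad` / `modulus_lShapeQuad` (modulus `1/2`, by the tree's symmetry principle
  `ConformalRectangle.crossRatio_eq_half_of_antiAffine`);
* `tendsto_half_lShapeQuad_of_rectilinearCardy`: the crux predicts that this L-shape is crossed
  (bottom side ↔ upper-left boundary around the notch) with probability `→ 1/2`. Numerically true
  (`0.5015(8), 0.4994(11), 0.5010(12)` at mesh `2/65, 2/129, 2/257` under the tree's exact
  discretisation, item evidence `NUMERICS-Lshape2.md`), so as a refutation attempt it misses; it is
  recorded as the reflex-corner analogue of the square test and as a template for one-step
  polygons (`CardyPolygonWords.CardyOneStep`, stmt-4783).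

References: Ch. Pommerenke, *Boundary Behaviour of Conformal Maps* (1992), §2.3
[PommerenkeBBCM1992]; J. Cardy, J. Phys. A 25 (1992) L201 [CardyJPhysA1992].
-/

noncomputable section

namespace Summit.CriticalPhenomena.CardyFormulaZ2.Theorems.RectilinearCardy.Negative

open Set Filter Topology Complex ComplexConjugate
open Literature.Probability.RandomPlanarGeometry
open Literature.Probability.Percolation (bondDomainCrossingProb)
open Summit.CriticalPhenomena.CardyFormulaZ2.Theses.CardyBoundaryCoulombGas (RectilinearCardy)

/-- Vertices of the L-shaped hexagon `(0,2)² ∖ [1,2]²`, counterclockwise from the origin. [folklore] -/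
def lVerts : List ℂ := [0, 2, 2 + I, 1 + I, 1 + 2 * I, 2 * I]

/-- Six vertices. [folklore] -/
@[simp] theorem length_lVerts : lVerts.length = 6 := rfl

/-- The L-shaped hexagon is a simple closed polygon (its half-open sides are pairwise disjoint). [folklore] -/
theorem isSimpleClosedPolygon_lVerts : IsSimpleClosedPolygon lVerts := by
  refine IsSimpleClosedPolygon.of_lt (by simp) ?_ ?_
  · intro k hk
    have : k < 6 := by simpa using hk
    interval_cases k <;> simp [lVerts, Complex.ext_iff]
  · intro i j hi hj hij
    have hj6 : j < 6 := by simpa using hj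
    interval_cases j <;> interval_cases i <;>
    · simp only [lVerts, List.length_cons, List.length_nil, Nat.reduceAdd, Nat.reduceMod,
        List.getElem_cons_zero, List.getElem_cons_succ, Set.disjoint_left]
      rintro _ ⟨θ, ⟨hθ0, hθ1⟩, rfl⟩ ⟨θ', ⟨hθ0', hθ1'⟩, h⟩
      have hre := congrArg Complex.re h
      have him := congrArg Complex.im h
      simp [AffineMap.lineMap_apply_module'] at hre him <;> nlinarith

/-- The L-shaped Jordan domain (inside of the hexagon, `polygonDomain`). [folklore] -/
def lShapeDomain : JordanDomain := polygonDomain lVerts isSimpleClosedPolygon_lVerts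

/-- Boundary parameters of the marks: vertices `0, 1, 3, 5` of the hexagon, i.e. the points
`0, 2, 1 + i, 2i` (the reflex corner `1 + i` is a mark). [folklore] -/
def lMarks : Fin 4 → ℝ := ![0, 1 / 6, 3 / 6, 5 / 6]

/-- **The L-shaped conformal rectangle** `((0,2)² ∖ [1,2]²; 0, 2, 1+i, 2i)` — a rectilinear
hexagon with a REFLEX corner, which is moreover a mark: crossing from the bottom side `[0, 2]` to
the upper-left part of the boundary `[1+i, 1+2i] ∪ [1+2i, 2i]` around the notch. [folklore] -/
def lShapeQuad : ConformalRectangle where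
  toJordanDomain := lShapeDomain
  mark := lMarks
  strictMono_mark := by
    refine Fin.strictMono_iff_lt_succ.2 fun i ↦ ?_
    fin_cases i <;> simp [lMarks] <;> norm_num
  mark_mem := by
    intro i
    fin_cases i <;> simp [lMarks] <;> norm_num

/-- The boundary loop is the closed hexagon. [folklore] -/
theorem lShapeQuad_boundary : lShapeQuad.boundary = polygonLoop lVerts := rfl

/-- The marked points, unfolded. [folklore] -/
theorem lShapeQuad_pt_eq (i : Fin 4) : lShapeQuad.pt i = polygonLoop lVerts (lMarks i) := rfl

/-- The marked points are `0, 2, 1 + i, 2i` (`polygonLoop_vertex`). [folklore] -/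
theorem lShapeQuad_pt :
    lShapeQuad.pt 0 = 0 ∧ lShapeQuad.pt 1 = 2 ∧ lShapeQuad.pt 2 = 1 + I ∧ lShapeQuad.pt 3 = 2 * I := by
  have h0 := polygonLoop_vertex (l := lVerts) (k := 0) (by simp)
  have h1 := polygonLoop_vertex (l := lVerts) (k := 1) (by simp)
  have h3 := polygonLoop_vertex (l := lVerts) (k := 3) (by simp)
  have h5 := polygonLoop_vertex (l := lVerts) (k := 5) (by simp)
  simp only [length_lVerts, Nat.cast_ofNat, Nat.cast_one, CharP.cast_eq_zero, zero_div] at h0 h1 h3 h5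
  simp only [lShapeQuad_pt_eq, lMarks, Matrix.cons_val_zero, Matrix.cons_val_one, Matrix.cons_val]
  refine ⟨?_, ?_, ?_, ?_⟩
  · rw [h0]; simp [lVerts]
  · rw [h1]; simp [lVerts]
  · rw [h3]; simp [lVerts]
  · rw [h5]; simp [lVerts]

/-- The boundary of the L-shape is the union of its six closed sides (`frontier_polygonDomain`). [folklore] -/
theorem frontier_lShapeQuad :
    frontier lShapeQuad.carrier = segment ℝ (0 : ℂ) 2 ∪ segment ℝ (2 : ℂ) (2 + I) ∪
      segment ℝ (2 + I) (1 + I) ∪ segment ℝ (1 + I) (1 + 2 * I) ∪ segment ℝ (1 + 2 * I) (2 * I) ∪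
      segment ℝ (2 * I) 0 := by
  have h := frontier_polygonDomain lVerts isSimpleClosedPolygon_lVerts
  change frontier lShapeDomain.carrier = _
  rw [show lShapeDomain = polygonDomain lVerts isSimpleClosedPolygon_lVerts from rfl, h]
  ext z
  simp only [mem_iUnion, mem_union]
  constructor
  · rintro ⟨k, hk⟩
    fin_cases k <;> simp [lVerts] at hk <;> tauto
  · rintro (((((h | h) | h) | h) | h) | h)
    · exact ⟨⟨0, by simp⟩, by simpa [lVerts] using h⟩
    · exact ⟨⟨1, by simp⟩, by simpa [lVerts] using h⟩
    · exact ⟨⟨2, by simp⟩, by simpa [lVerts] using h⟩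
    · exact ⟨⟨3, by simp⟩, by simpa [lVerts] using h⟩
    · exact ⟨⟨4, by simp⟩, by simpa [lVerts] using h⟩
    · exact ⟨⟨5, by simp⟩, by simpa [lVerts] using h⟩

/-! ### The diagonal symmetry `z ↦ i z̄` of the L-shape -/

/-- The reflection in the diagonal `y = x`, `z ↦ i z̄` (`= antiAffine I 0`), as an `ℝ`-linear map. [folklore] -/
def swapL : ℂ →ₗ[ℝ] ℂ where
  toFun z := I * conj z
  map_add' z w := by simp only [map_add, mul_add]
  map_smul' r z := by
    apply Complex.ext <;> simp

/-- Formula. [folklore] -/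
@[simp] theorem swapL_apply (z : ℂ) : swapL z = I * conj z := rfl

/-- The reflection is an involution. [folklore] -/
theorem swapL_swapL (z : ℂ) : swapL (swapL z) = z := by
  apply Complex.ext <;> simp

/-- The reflection as a homeomorphism of the plane. [folklore] -/
def swapH : ℂ ≃ₜ ℂ where
  toFun := swapL
  invFun := swapL
  left_inv := swapL_swapL
  right_inv := swapL_swapL
  continuous_toFun := by
    show Continuous fun z : ℂ ↦ I * conj z
    fun_prop
  continuous_invFun := by
    show Continuous fun z : ℂ ↦ I * conj z
    fun_prop

/-- Formula. [folklore] -/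
@[simp] theorem swapH_apply (z : ℂ) : swapH z = I * conj z := rfl

/-- `antiAffine I 0` is this reflection. [folklore] -/
theorem antiAffine_I_zero (z : ℂ) : antiAffine I 0 z = swapH z := by simp

/-- A linear map sends segments to segments. [folklore] -/
theorem swapL_image_segment (a b : ℂ) : swapL '' segment ℝ a b = segment ℝ (swapL a) (swapL b) := by
  have := image_segment ℝ swapL.toAffineMap a b
  simpa using this

/-- The reflection preserves the boundary hexagon (it reverses the list of sides). [folklore] -/
theorem swapH_image_frontier : swapH '' frontier lShapeQuad.carrier = frontier lShapeQuad.carrier := by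
  have hcoe : (swapH : ℂ → ℂ) = swapL := rfl
  rw [frontier_lShapeQuad, hcoe]
  simp only [image_union, swapL_image_segment]
  have e0 : swapL 0 = 0 := by apply Complex.ext <;> simp
  have e1 : swapL 2 = 2 * I := by apply Complex.ext <;> simp
  have e2 : swapL (2 + I) = 1 + 2 * I := by apply Complex.ext <;> simp
  have e3 : swapL (1 + I) = 1 + I := by apply Complex.ext <;> simp
  have e4 : swapL (1 + 2 * I) = 2 + I := by apply Complex.ext <;> simp
  have e5 : swapL (2 * I) = 2 := by apply Complex.ext <;> simp
  rw [e0, e1, e2, e3, e4, e5]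
  ext z
  simp only [mem_union, segment_symm ℝ (2 * I) 0, segment_symm ℝ (1 + 2 * I) (2 * I),
    segment_symm ℝ (1 + I) (1 + 2 * I), segment_symm ℝ (2 + I) (1 + I), segment_symm ℝ (2 : ℂ) (2 + I),
    segment_symm ℝ (0 : ℂ) 2]
  tauto

/-- The reflection maps the L-shape onto itself (the inside of a Jordan curve is determined by the
curve, `JordanDomain.carrier_eq_of_frontier_eq`, applied to the image domain `JordanDomain.map`). [folklore] -/
theorem swapH_image_carrier : swapH '' lShapeQuad.carrier = lShapeQuad.carrier := by
  have h : frontier (lShapeQuad.toJordanDomain.map swapH).carrier = frontier lShapeQuad.carrier := by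
    rw [JordanDomain.carrier_map, ← swapH.image_frontier, swapH_image_frontier]
  exact JordanDomain.carrier_eq_of_frontier_eq h

/-- `antiAffine I 0` maps the L-shape into itself. [folklore] -/
theorem mapsTo_antiAffine_lShapeQuad : MapsTo (antiAffine I 0) lShapeQuad.carrier lShapeQuad.carrier := by
  intro z hz
  rw [antiAffine_I_zero, ← swapH_image_carrier]
  exact mem_image_of_mem _ hz

/-- **The L-shape `((0,2)² ∖ [1,2]²; 0, 2, 1+i, 2i)` has conformal modulus `1/2`** for every
uniformizing datum: the reflection `z ↦ i z̄` preserves the domain, fixes the marks `0` and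
`1 + i` (the reflex corner) and swaps `2 ↔ 2i` (tree symmetry principle
`ConformalRectangle.crossRatio_eq_half_of_antiAffine`). [folklore] -/
theorem crossRatio_lShapeQuad {φ : ConformalEquiv UpperHalfPlane.upperHalfPlaneSet lShapeQuad.carrier}
    {x : Fin 4 → ℝ} (h : lShapeQuad.IsUniformizing φ x) : crossRatio x = 1 / 2 := by
  obtain ⟨h0, h1, h2, h3⟩ := lShapeQuad_pt
  refine ConformalRectangle.crossRatio_eq_half_of_antiAffine lShapeQuad (u := I) (v := 0)
    (by simp) (by simp) mapsTo_antiAffine_lShapeQuad ?_ ?_ ?_ h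
  · rw [h0]; simp
  · rw [h2]; apply Complex.ext <;> simp
  · rw [h1, h3]; apply Complex.ext <;> simp


/-- The L-shape is an instance of the crux: its boundary lies in six axis-parallel segments. [folklore] -/
theorem isRectilinear_lShapeQuad : IsRectilinear lShapeQuad := by
  classical
  refine ⟨{((0 : ℂ), (2 : ℂ)), ((2 : ℂ), 2 + I), (2 + I, 1 + I), (1 + I, 1 + 2 * I),
    (1 + 2 * I, 2 * I), (2 * I, (0 : ℂ))}, ?_, ?_⟩
  · intro p hp
    simp only [Finset.mem_insert, Finset.mem_singleton] at hp
    rcases hp with rfl | rfl | rfl | rfl | rfl | rfl <;> simp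
  · rw [frontier_lShapeQuad]
    intro z hz
    simp only [mem_iUnion, Finset.mem_insert, Finset.mem_singleton, exists_prop]
    rcases hz with (((((h | h) | h) | h) | h) | h)
    · exact ⟨_, Or.inl rfl, h⟩
    · exact ⟨_, Or.inr (Or.inl rfl), h⟩
    · exact ⟨_, Or.inr (Or.inr (Or.inl rfl)), h⟩
    · exact ⟨_, Or.inr (Or.inr (Or.inr (Or.inl rfl))), h⟩
    · exact ⟨_, Or.inr (Or.inr (Or.inr (Or.inr (Or.inl rfl)))), h⟩
    · exact ⟨_, Or.inr (Or.inr (Or.inr (Or.inr (Or.inr rfl)))), h⟩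

/-- The modulus of the L-shape `((0,2)² ∖ [1,2]²; 0, 2, 1+i, 2i)` is `1/2`. [folklore] -/
theorem modulus_lShapeQuad : modulus lShapeQuad = 1 / 2 :=
  (crossRatio_eq_modulus (isUniformizing_modulusDatum lShapeQuad)).symm.trans
    (crossRatio_lShapeQuad (isUniformizing_modulusDatum lShapeQuad))

/-- **Crux ⇒ the L-shape with a mark at its reflex corner is crossed with probability `→ 1/2`**
(bottom side ↔ upper-left boundary around the notch). NOT a refutation: numerically the limit is
`1/2` to `0.1 %`. [folklore] -/
theorem tendsto_half_lShapeQuad_of_rectilinearCardy (h : RectilinearCardy) :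
    Tendsto (bondDomainCrossingProb lShapeQuad) (𝓝[>] 0) (𝓝 (1 / 2)) := by
  have := hasCrossingLimit_iff_modulus.1 (h lShapeQuad isRectilinear_lShapeQuad)
  rwa [modulus_lShapeQuad, cardyFunction_half] at this

/-- Contrapositive: if the L-shape crossing probabilities do not tend to `1/2`, the crux fails. [folklore] -/
theorem not_rectilinearCardy_of_not_tendsto_half_lShapeQuad
    (h : ¬ Tendsto (bondDomainCrossingProb lShapeQuad) (𝓝[>] 0) (𝓝 (1 / 2))) : ¬ RectilinearCardy :=
  fun h' ↦ h (tendsto_half_lShapeQuad_of_rectilinearCardy h')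

end Summit.CriticalPhenomena.CardyFormulaZ2.Theorems.RectilinearCardy.Negative

end
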